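import HarnessLib
import Literature.NumberTheory.LFunctions.DedekindZetaERHProofs
import Literature.NumberTheory.LFunctions.DedekindZetaNonvanishing

/-!
# `QuinticDedekindPole` (stmt-Langlands-17270) — Negative knowledge: the closed half-plane
# `Re s ≥ 1`, the pole `s = 1` included, carries NO obstruction (refuted natural strengthening)

Crux-disprover lemma (cdisprove, 2026-08-17) for the crux `QuinticDedekindPole` of route
`DedekindQuotient1951` ("`ζ_K/ζ` is not holomorphic on `{0 < Re s ∧ |Im s| < 100}`" for the
Doud–Moore quintic field `K`, with `g · ζ = ζ_K` demanded on `1 < Re s`).  Where can a TRUE-witness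
live?  Not on `Re s ≥ 1`:

* `exists_dedekindQuotient_differentiableAt_of_one_le_re` — for EVERY number field `K` there is `g`
  complex-differentiable at every point of the closed half-plane `Re s ≥ 1` with `g · ζ = ζ_K`
  (Dirichlet series) on `Re s > 1`: off `s = 1` it is `ζ_K^cont/ζ` (`ζ ≠ 0` on `Re s ≥ 1`,
  `riemannZeta_ne_zero_of_one_le_re`; `ζ_K^cont` holomorphic off `1`,
  `differentiableOn_dedekindZetaCont_holds`), and at `s = 1` the two simple poles cancel —
  `(s-1)ζ_K^cont(s) → Res ζ_K` (`tendsto_sub_one_mul_dedekindZetaCont_holds`), `(s-1)ζ(s) → 1`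
  (`riemannZeta_residue_one`) — so the quotient is bounded near `1` and Riemann's removable
  singularity theorem (`Complex.differentiableOn_update_limUnder_of_bddAbove`) applies;
* `exists_doudMoore_generated_numberField` — a number field generated by a root of the quintic
  exists (an irreducible factor and `AdjoinRoot`; stated only to instantiate the binders);
* `not_quinticDedekindPole_on_closedHalfPlane` — hence the NATURAL STRENGTHENING of the crux that
  asks the obstruction to be visible already for `g` merely holomorphic at each point of `Re s ≥ 1`
  is FALSE.

Consequence for provers/planners: a TRUE-certificate is necessarily a zero `ρ` of `ζ` with
`0 < Re ρ < 1`, `|Im ρ| < 100` and `ord_ρ ζ_K^cont < ord_ρ ζ` (a pole of `L(s, ρ₄)`), nothing else;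
the pole of `ζ_K` at `1` and the line `Re s = 1` are harmless.
No statement of the route is used or asserted. [folklore]
-/

set_option linter.dupNamespace false -- project-wide option (lakefile weak.linter.dupNamespace); `Summit.Langlands.Langlands` is the mandated namespace

noncomputable section

open scoped Topology NumberField
open Filter Set Complex Polynomial
open Literature.NumberTheory.LFunctions

namespace Summit.Langlands.Langlands.Theorems.QuinticDedekindPole.Negative

/-- **`ζ_K/ζ` is holomorphic on a neighbourhood of the closed half-plane `Re s ≥ 1`** (every number
field `K`): some `g`, complex-differentiable at every `s` with `Re s ≥ 1`, satisfies `g · ζ = ζ_K`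
(Dirichlet series) on `Re s > 1`.  Removable singularity at `s = 1` by the two residue theorems.
[folklore] -/
theorem exists_dedekindQuotient_differentiableAt_of_one_le_re (K : Type*) [Field K] [NumberField K] :
    ∃ g : ℂ → ℂ, (∀ s : ℂ, 1 ≤ s.re → DifferentiableAt ℂ g s) ∧
      ∀ s : ℂ, 1 < s.re → g s * riemannZeta s = NumberField.dedekindZeta K s := by
  set q : ℂ → ℂ := fun s => dedekindZetaCont K s / riemannZeta s with hq
  -- differentiability of `q` off `1` wherever `ζ ≠ 0`
  have hqdiff : ∀ s : ℂ, s ≠ 1 → riemannZeta s ≠ 0 → DifferentiableAt ℂ q s := by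
    intro s h1 hζ
    have hK : DifferentiableAt ℂ (dedekindZetaCont K) s :=
      (differentiableOn_dedekindZetaCont_holds K).differentiableAt
        (isOpen_compl_singleton.mem_nhds h1)
    exact hK.div (differentiableAt_riemannZeta h1) hζ
  -- the limit of `q` at `1`: the simple poles cancel
  have hlim : Tendsto q (𝓝[≠] 1) (𝓝 (NumberField.dedekindZeta_residue K : ℂ)) := by
    have h := (tendsto_sub_one_mul_dedekindZetaCont_holds K).div riemannZeta_residue_one one_ne_zero
    rw [div_one] at h
    refine h.congr' ?_
    filter_upwards [self_mem_nhdsWithin] with s hs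
    have hs1 : s - 1 ≠ 0 := sub_ne_zero.mpr hs
    simp only [hq, Pi.div_apply]
    rw [mul_div_mul_left _ _ hs1]
  -- `q` is bounded and differentiable on a punctured neighbourhood of `1`
  have hev : ∀ᶠ s in 𝓝[≠] (1 : ℂ),
      ‖q s‖ < ‖(NumberField.dedekindZeta_residue K : ℂ)‖ + 1 ∧ DifferentiableAt ℂ q s := by
    have h1 : ∀ᶠ s in 𝓝[≠] (1 : ℂ), ‖q s‖ < ‖(NumberField.dedekindZeta_residue K : ℂ)‖ + 1 :=
      hlim.norm.eventually (gt_mem_nhds (lt_add_one _))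
    have h2 : ∀ᶠ s in 𝓝[≠] (1 : ℂ), (s - 1) * riemannZeta s ≠ 0 :=
      riemannZeta_residue_one.eventually_ne one_ne_zero
    filter_upwards [h1, h2, self_mem_nhdsWithin] with s hs1 hs2 hs3
    exact ⟨hs1, hqdiff s hs3 (right_ne_zero_of_mul hs2)⟩
  obtain ⟨U, hU, hUsub⟩ := mem_nhdsWithin_iff_exists_mem_nhds_inter.mp hev
  have hdiffU : DifferentiableOn ℂ q (U \ {1}) := fun s hs =>
    (hUsub ⟨hs.1, hs.2⟩).2.differentiableWithinAt
  have hbdd : BddAbove (norm ∘ q '' (U \ {1})) := by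
    refine ⟨‖(NumberField.dedekindZeta_residue K : ℂ)‖ + 1, ?_⟩
    rintro _ ⟨s, hs, rfl⟩
    exact (hUsub ⟨hs.1, hs.2⟩).1.le
  have hg1 : DifferentiableOn ℂ (Function.update q 1 (limUnder (𝓝[≠] 1) q)) U :=
    Complex.differentiableOn_update_limUnder_of_bddAbove hU hdiffU hbdd
  refine ⟨Function.update q 1 (limUnder (𝓝[≠] 1) q), fun s hs => ?_, fun s hs => ?_⟩
  · by_cases h1 : s = 1
    · subst h1
      exact hg1.differentiableAt hU
    · refine (hqdiff s h1 (riemannZeta_ne_zero_of_one_le_re hs)).congr_of_eventuallyEq ?_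
      filter_upwards [isOpen_compl_singleton.mem_nhds h1] with z hz
      exact Function.update_of_ne hz _ _
  · have h1 : s ≠ 1 := by
      rintro rfl
      simp at hs
    rw [Function.update_of_ne h1]
    simp only [hq]
    rw [div_mul_cancel₀ _ (riemannZeta_ne_zero_of_one_lt_re hs),
      dedekindZetaCont_eq_dedekindZeta_holds hs]

/-- A number field generated by a root of the Doud–Moore quintic (an irreducible factor of `f` over
`ℚ` and `AdjoinRoot`; irreducibility of `f` itself is not needed for existence). [folklore] -/
theorem exists_doudMoore_generated_numberField :
    ∃ (K : Type) (_ : Field K) (_ : NumberField K) (θ : K),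
      θ ^ 5 - θ ^ 4 - 780 * θ ^ 3 + 9911 * θ ^ 2 - 24208 * θ + 15952 = 0 ∧
      IntermediateField.adjoin ℚ ({θ} : Set K) = ⊤ := by
  set f : ℚ[X] := X ^ 5 - X ^ 4 - 780 * X ^ 3 + 9911 * X ^ 2 - 24208 * X + 15952 with hf
  have hmon : f.Monic := by rw [hf]; monicity!
  have hdeg : f.natDegree = 5 := by rw [hf]; compute_degree!
  have hnu : ¬ IsUnit f := fun hu => by
    have h0 := Polynomial.natDegree_eq_zero_of_isUnit hu
    omega
  obtain ⟨g, hg, hgf⟩ := WfDvdMonoid.exists_irreducible_factor hnu hmon.ne_zero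
  haveI : Fact (Irreducible g) := ⟨hg⟩
  refine ⟨AdjoinRoot g, inferInstance, inferInstance, AdjoinRoot.root g, ?_, ?_⟩
  · have h0 : @aeval ℚ (AdjoinRoot g) _ _ (AdjoinRoot.instAlgebra g) (AdjoinRoot.root g) f = 0 := by
      rw [AdjoinRoot.aeval_eq, AdjoinRoot.mk_eq_zero]
      exact hgf
    have h1 : @aeval ℚ (AdjoinRoot g) _ _ (AdjoinRoot.instAlgebra g) (AdjoinRoot.root g) f =
        (AdjoinRoot.root g) ^ 5 - (AdjoinRoot.root g) ^ 4 -
        780 * (AdjoinRoot.root g) ^ 3 + 9911 * (AdjoinRoot.root g) ^ 2 -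
        24208 * (AdjoinRoot.root g) + 15952 := by
      simp only [hf, map_add, map_sub, map_mul, map_pow, aeval_X, map_ofNat]
    rw [← h1, h0]
  · have hinst : (DivisionRing.toRatAlgebra : Algebra ℚ (AdjoinRoot g)) = AdjoinRoot.instAlgebra g :=
      Subsingleton.elim _ _
    rw [hinst]
    refine eq_top_iff.mpr fun x _ => ?_
    have hx : x ∈ @Algebra.adjoin ℚ (AdjoinRoot g) _ _ (AdjoinRoot.instAlgebra g)
        {AdjoinRoot.root g} := by
      rw [AdjoinRoot.adjoinRoot_eq_top]; trivial
    exact IntermediateField.algebra_adjoin_le_adjoin ℚ _ hx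

/-- **Refuted natural strengthening of `QuinticDedekindPole`.** If the obstruction is demanded
already for functions `g` that are merely complex-differentiable at every point of the CLOSED
half-plane `Re s ≥ 1` (with `g · ζ = ζ_K` on `1 < Re s`, `|Im s| < 100`), the statement is FALSE:
the Doud–Moore field (indeed every number field) admits such a `g`.  Any TRUE-witness of the crux
therefore sits at a zero of `ζ` in the open critical strip below height `100`. [folklore] -/
theorem not_quinticDedekindPole_on_closedHalfPlane :
    ¬ ∀ (K : Type) [Field K] [NumberField K] (θ : K),
        θ ^ 5 - θ ^ 4 - 780 * θ ^ 3 + 9911 * θ ^ 2 - 24208 * θ + 15952 = 0 →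
        IntermediateField.adjoin ℚ ({θ} : Set K) = ⊤ →
        ¬ ∃ g : ℂ → ℂ, (∀ s : ℂ, 1 ≤ s.re → DifferentiableAt ℂ g s) ∧
          ∀ s : ℂ, 1 < s.re → |s.im| < 100 →
            g s * riemannZeta s = NumberField.dedekindZeta K s := by
  intro h
  obtain ⟨K, _, _, θ, hθ, hgen⟩ := exists_doudMoore_generated_numberField
  obtain ⟨g, hg, hgeq⟩ := exists_dedekindQuotient_differentiableAt_of_one_le_re K
  exact h K θ hθ hgen ⟨g, hg, fun s hs _ => hgeq s hs⟩

end Summit.Langlands.Langlands.Theorems.QuinticDedekindPole.Negative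

end
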